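import Summits.Parity.BatemanHorn.Theorems.SoloInformedHooleyMeanLocalMoments
import Literature.Barriers.AtomisticToContinuum.DisorderedHarmonicChainSmoothing

/-!
# Pair correlation of the root fractions `ν/e`: the Fejér identity behind `HooleyMeanSquareLocal`

Informed soloist `solo-Parity-informed` (session 144), conjunct `BatemanHorn`, the `d ≥ 3` rung BELOW the parity wall
(`ErdosDivisorSumAsymptotic g` for an irreducible cubic `g` ⟸ cancellation in the Hooley sums
`S_g(h;e) = ∑_{g(ν)≡0 (e)} e(hν/e)` over dyadic ranges of moduli: `SoloInformedHooleyMeanLocal`,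
`SoloInformedHooleyMeanLocalMoments`).  The second-moment hypothesis `HooleyMeanSquareLocal g θ η` is rewritten
EXACTLY as a statement about the PAIR CORRELATION of the finite family of points `x_p = ν/e ∈ ℝ/ℤ`,
`p = (e, ν)`, `E < e ≤ E'`, `0 ≤ ν < e`, `g(ν) ≡ 0 (mod e)` (`rootPoints g E E'`; there are
`N = #rootPoints = ∑_{E<e≤E'} ρ_g(e)` of them, `card_rootPoints`), at scale `1/H`:

* `rootPairSum g E E' H = ∑_{p,p'} F_H(x_p − x_{p'})`, where `F_H = fejer H` is the Fejér kernel ALREADY in the tree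
  (`Literature.Barriers.AtomisticToContinuum.HeatConduction.fejer`, with `fejer_nonneg`, `fejer_le : F_H ≤ 2H`,
  `fejer_le_inv_sq : F_H(s) ≤ 1/(4Hs²)`, `integral_fejer : ∫ F_H = 1` — a bump of height `≍ H` and width `≍ 1/H`;
  nothing about that file's physics is used): `rootPairSum` counts, with smooth weights of size `≍ H`, the ORDERED
  PAIRS of root fractions at mutual distance `≲ 1/H` on the circle;
* **the identity** (`mul_rootPairSum_eq_sum_sum`, `mul_rootPairSum_eq`):
  `H · rootPairSum g E E' H = ∑_{0≤k,k'<H} ‖T(k − k')‖² = H·N² + ∑_{1≤h≤H} (H − h)·(‖T(h)‖² + ‖T(−h)‖²)`,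
  where `T(h) = ∑_{E<e≤E'} S_g(h;e)` (`T(0) = N`): a finite Parseval/Fejér computation, two elementary identities
  (`sum_range_sum_range_sub`, `norm_sq_sum_exp_mul_I`) and nothing else;
* hence the sandwich `rootPairSum(H) − N² ≤ ∑_{1≤h≤H} (‖T(h)‖² + ‖T(−h)‖²) ≤ 2·(rootPairSum(2H) − N²)`
  (`rootPairSum_sub_sq_le`, `sum_Icc_norm_sq_le`) and the equivalence — up to the harmless factor `2` in the admissible
  range of `H` — of `HooleyMeanSquareLocal g θ η` with the PAIR-CORRELATION HYPOTHESIS `HooleyPairCorrelationLocal g θ η`: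
  `rootPairSum g E E' H ≤ N² + C·H·E^{2(1−η)}` for all dyadic `(E, E']` and `H ≤ 2E^θ`
  (`hooleyMeanSquareLocal_of_pairCorrelation`, `HooleyMeanSquareLocal.rootPairSum_le`), with the cubic corollary
  `erdosDivisorSumAsymptotic_cubic_of_pairCorrelation` (`θ > 2/3`, `θ ≤ 1`, `η > 1/3`).

READING (prose only).  In `rootPairSum(H)` the diagonal `p = p'` contributes `N·F_H(0) = N·H ≍ H·E`, and a family of
`N` independent uniform points would give `N·H + (N² − N)` in mean (`N²` ordered pairs, a proportion `≍ 1/H` of them at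
distance `≲ 1/H`, each weighted `≍ H`), i.e. a deviation `rootPairSum − N² ≈ N·(H − 1)` of the size of the diagonal; so the
exponent `η = 1/2` — the square-root (random-walk) heuristic `∑_{h≤H}‖T(h)‖² ≍ H·N` — says precisely "the smoothed pair
counts of the `N ≍ E` root fractions exceed the mean-density prediction `N²` by at most a constant multiple of the POISSONIAN
size `H·N`, at all scales `1/H ≥ E^{−θ}/2`".  The hypothesis is ONE-SIDED: repulsion / rigidity only helps (for `N` equally
spaced points `T(h) = 0` for `0 < |h| < N` and the deviation vanishes), and `η > 1/2` would mean sub-random cancellation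
`∑_{h≤H}‖T(h)‖² = o(H·N)` — lattice-like rigidity, not expected for root fractions but not excluded by anything typed here.
The cubic Erdős asymptotic needs only `η > 1/3` with `θ > 2/3`: pair counts at scales down to `≍ E^{−2/3−δ}` with deviation
`≪ H·E^{4/3−2δ}` from `N²`, against the Poissonian size `H·E` and the trivial bound `rootPairSum ≤ 2H·N²` (`rootPairSum_le`).
For QUADRATIC `g` the fine-scale pair correlation of the roots is a theorem and is NOT Poissonian (J. Marklof, M. Welsh,
*Fine-scale distribution of roots of quadratic congruences*, Duke Math. J. (2023), arXiv:2105.02854, Thm 1.1: an explicit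
limit density `≠ 1`, via equidistribution of horocycles); for `deg g ≥ 3` only Hooley's equidistribution of `ν/e` (Mathematika 11
(1964)), saving a power of `log E` in `T(h)`, is in print, and M. Welsh, *Parametrizing roots of polynomial congruences*,
Algebra Number Theory 16 (2022), arXiv:2008.00538, p. 7, records why the `SL(3)` spectral route to statistics of cubic roots has
not delivered.  The CRT structure of the cross terms `e ≠ e'` is typed in the companion file `SoloInformedRootPairCRT`.
No parity-blocked statement is touched: everything here lives below the wall (`SoloInformedLocatedHeuristic`).
-/

namespace Summit.Parity.BatemanHorn.Theorems

open Finset Polynomial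
open Literature.NumberTheory.Sieve (polyRootCountMod)
open Literature.Barriers.AtomisticToContinuum.HeatConduction (fejer fejer_nonneg fejer_le fejer_eq_sum_sum)

/-! ### Two elementary identities -/

/-- Counting the pairs `0 ≤ m, m' < H` by their difference:
`∑_{m,m'<H} f(m − m') = H·f(0) + ∑_{0≤d<H} (H − (d+1))·(f(d+1) + f(−(d+1)))`. [folklore] -/
theorem sum_range_sum_range_sub (f : ℤ → ℝ) (H : ℕ) :
    ∑ m ∈ range H, ∑ m' ∈ range H, f ((m : ℤ) - m') =
      (H : ℝ) * f 0 + ∑ d ∈ range H, ((H : ℝ) - (d + 1)) * (f ((d : ℤ) + 1) + f (-((d : ℤ) + 1))) := by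
  induction H with
  | zero => simp
  | succ H ih =>
    have hA : ∑ m' ∈ range H, f ((H : ℤ) - m') = ∑ d ∈ range H, f ((d : ℤ) + 1) := by
      rw [← sum_range_reflect (fun d => f ((d : ℤ) + 1)) H]
      refine sum_congr rfl fun j hj => ?_
      have hj' := mem_range.mp hj
      have hc : ((H - 1 - j : ℕ) : ℤ) = (H : ℤ) - 1 - j := by omega
      rw [hc]
      congr 1
      ring
    have hB : ∑ m ∈ range H, f ((m : ℤ) - H) = ∑ d ∈ range H, f (-((d : ℤ) + 1)) := by
      rw [← sum_range_reflect (fun d => f (-((d : ℤ) + 1))) H]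
      refine sum_congr rfl fun j hj => ?_
      have hj' := mem_range.mp hj
      have hc : ((H - 1 - j : ℕ) : ℤ) = (H : ℤ) - 1 - j := by omega
      rw [hc]
      congr 1
      ring
    have hC : ∑ d ∈ range H, (((H : ℝ) + 1) - (d + 1)) * (f ((d : ℤ) + 1) + f (-((d : ℤ) + 1))) =
        ∑ d ∈ range H, ((H : ℝ) - (d + 1)) * (f ((d : ℤ) + 1) + f (-((d : ℤ) + 1)))
          + (∑ d ∈ range H, f ((d : ℤ) + 1) + ∑ d ∈ range H, f (-((d : ℤ) + 1))) := by
      rw [← sum_add_distrib, ← sum_add_distrib]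
      exact sum_congr rfl fun d _ => by ring
    simp only [sum_range_succ, sum_add_distrib, Nat.cast_succ, sub_self, zero_mul, add_zero]
    rw [ih, hA, hB, hC]
    ring

/-- `‖∑_p e^{i a_p}‖² = ∑_{p,p'} cos(a_p − a_{p'})`. [folklore] -/
theorem norm_sq_sum_exp_mul_I {ι : Type*} (s : Finset ι) (a : ι → ℝ) :
    ‖∑ p ∈ s, Complex.exp ((a p : ℂ) * Complex.I)‖ ^ 2 = ∑ p ∈ s, ∑ p' ∈ s, Real.cos (a p - a p') := by
  have hre : (∑ p ∈ s, Complex.exp ((a p : ℂ) * Complex.I)).re = ∑ p ∈ s, Real.cos (a p) := by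
    rw [Complex.re_sum]
    exact sum_congr rfl fun p _ => Complex.exp_ofReal_mul_I_re _
  have him : (∑ p ∈ s, Complex.exp ((a p : ℂ) * Complex.I)).im = ∑ p ∈ s, Real.sin (a p) := by
    rw [Complex.im_sum]
    exact sum_congr rfl fun p _ => Complex.exp_ofReal_mul_I_im _
  rw [Complex.sq_norm, Complex.normSq_apply, hre, him, sum_mul_sum, sum_mul_sum, ← sum_add_distrib]
  refine sum_congr rfl fun p _ => ?_
  rw [← sum_add_distrib]
  exact sum_congr rfl fun p' _ => by rw [Real.cos_sub]

/-- `e_q(k) = exp(i · (2πk/q))` with a REAL phase. [folklore] -/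
theorem eAdd_eq_exp_ofReal_mul_I (q : ℕ) (k : ℤ) :
    eAdd q k = Complex.exp (((2 * Real.pi * k / q : ℝ) : ℂ) * Complex.I) := by
  unfold eAdd
  congr 1
  push_cast
  ring

/-- `H · F_H(s) = ∑_{0≤k,k'<H} cos(2π(k − k')s)` (also for `H = 0`). [folklore] -/
theorem natCast_mul_fejer (H : ℕ) (s : ℝ) :
    (H : ℝ) * fejer H s = ∑ k ∈ range H, ∑ k' ∈ range H, Real.cos (2 * Real.pi * ((k : ℝ) - k') * s) := by
  rcases Nat.eq_zero_or_pos H with rfl | hH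
  · simp
  · rw [fejer_eq_sum_sum, ← mul_assoc, mul_one_div_cancel (by positivity), one_mul]

/-! ### The root points of a dyadic range and their Fejér pair sum -/

/-- The ROOT POINTS of the range `(E, E']`: pairs `p = ⟨e, ν⟩` with `E < e ≤ E'`, `0 ≤ ν < e`, `g(ν) ≡ 0 (mod e)`;
the point `p` carries the root fraction `x_p = ν/e ∈ [0, 1)`. [this work] -/
def rootPoints (g : ℤ[X]) (E E' : ℕ) : Finset (Σ _ : ℕ, ℕ) :=
  (Ioc E E').sigma fun e => rootResidues g e

/-- `N = #rootPoints = ∑_{E<e≤E'} ρ_g(e)`. [this work] -/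
theorem card_rootPoints (g : ℤ[X]) (E E' : ℕ) :
    #(rootPoints g E E') = ∑ e ∈ Ioc E E', polyRootCountMod ![g] e := by
  rw [rootPoints, card_sigma]
  exact sum_congr rfl fun e _ => card_rootResidues g e

/-- `T(h) = ∑_{E<e≤E'} S_g(h;e) = ∑_p e(h·x_p)`: the exponential sum over the root points. [this work] -/
theorem sum_Ioc_hooleySum_eq_sum_rootPoints (g : ℤ[X]) (E E' : ℕ) (h : ℤ) :
    ∑ e ∈ Ioc E E', hooleySum g e h = ∑ p ∈ rootPoints g E E', eAdd p.1 (h * p.2) := by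
  unfold hooleySum rootPoints
  rw [sum_sigma]

/-- `T(0) = N`. [this work] -/
theorem sum_Ioc_hooleySum_zero (g : ℤ[X]) (E E' : ℕ) :
    ∑ e ∈ Ioc E E', hooleySum g e 0 = (#(rootPoints g E E') : ℂ) := by
  rw [card_rootPoints, Nat.cast_sum]
  exact sum_congr rfl fun e _ => hooleySum_zero g e

/-- `‖T(0)‖ = N`. [this work] -/
theorem norm_sum_Ioc_hooleySum_zero (g : ℤ[X]) (E E' : ℕ) :
    ‖∑ e ∈ Ioc E E', hooleySum g e 0‖ = #(rootPoints g E E') := by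
  rw [sum_Ioc_hooleySum_zero, Complex.norm_natCast]

/-- `‖T(h)‖² = ∑_{p,p'} cos(2πh(x_p − x_{p'}))`. [this work] -/
theorem norm_sq_sum_Ioc_hooleySum (g : ℤ[X]) (E E' : ℕ) (h : ℤ) :
    ‖∑ e ∈ Ioc E E', hooleySum g e h‖ ^ 2 =
      ∑ p ∈ rootPoints g E E', ∑ p' ∈ rootPoints g E E',
        Real.cos (2 * Real.pi * h * ((p.2 : ℝ) / p.1 - (p'.2 : ℝ) / p'.1)) := by
  rw [sum_Ioc_hooleySum_eq_sum_rootPoints]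
  simp_rw [eAdd_eq_exp_ofReal_mul_I]
  rw [norm_sq_sum_exp_mul_I]
  refine sum_congr rfl fun p _ => sum_congr rfl fun p' _ => ?_
  congr 1
  push_cast
  ring

/-- The FEJÉR PAIR SUM of the root fractions of the range `(E, E']` at scale `1/H`:
`rootPairSum g E E' H = ∑_{p,p'} F_H(x_p − x_{p'})`. [this work] -/
noncomputable def rootPairSum (g : ℤ[X]) (E E' H : ℕ) : ℝ :=
  ∑ p ∈ rootPoints g E E', ∑ p' ∈ rootPoints g E E', fejer H ((p.2 : ℝ) / p.1 - (p'.2 : ℝ) / p'.1)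

/-- `rootPairSum ≥ 0`. [this work] -/
theorem rootPairSum_nonneg (g : ℤ[X]) (E E' H : ℕ) : 0 ≤ rootPairSum g E E' H :=
  sum_nonneg fun _ _ => sum_nonneg fun _ _ => fejer_nonneg _ _

/-- The trivial bound `rootPairSum ≤ 2H·N²`. [this work] -/
theorem rootPairSum_le (g : ℤ[X]) (E E' H : ℕ) :
    rootPairSum g E E' H ≤ 2 * H * (#(rootPoints g E E') : ℝ) ^ 2 := by
  calc rootPairSum g E E' H ≤ ∑ p ∈ rootPoints g E E', ∑ p' ∈ rootPoints g E E', (2 * H : ℝ) :=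
        sum_le_sum fun _ _ => sum_le_sum fun _ _ => fejer_le _ _
    _ = 2 * H * (#(rootPoints g E E') : ℝ) ^ 2 := by
        simp only [sum_const, nsmul_eq_mul]
        ring

/-- `rootPairSum` block by block: `∑_{e,e'} ∑_{ν (mod e), ν' (mod e')} F_H(ν/e − ν'/e')`. [this work] -/
theorem rootPairSum_eq_sum_moduli (g : ℤ[X]) (E E' H : ℕ) :
    rootPairSum g E E' H = ∑ e ∈ Ioc E E', ∑ e' ∈ Ioc E E', ∑ ν ∈ rootResidues g e, ∑ ν' ∈ rootResidues g e',
      fejer H ((ν : ℝ) / e - (ν' : ℝ) / e') := by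
  unfold rootPairSum rootPoints
  rw [sum_sigma]
  refine sum_congr rfl fun e _ => ?_
  calc ∑ ν ∈ rootResidues g e, ∑ p' ∈ (Ioc E E').sigma (fun e' => rootResidues g e'),
          fejer H ((ν : ℝ) / e - (p'.2 : ℝ) / p'.1)
      = ∑ p' ∈ (Ioc E E').sigma (fun e' => rootResidues g e'), ∑ ν ∈ rootResidues g e,
          fejer H ((ν : ℝ) / e - (p'.2 : ℝ) / p'.1) := sum_comm
    _ = ∑ e' ∈ Ioc E E', ∑ ν' ∈ rootResidues g e', ∑ ν ∈ rootResidues g e,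
          fejer H ((ν : ℝ) / e - (ν' : ℝ) / e') := by rw [sum_sigma]
    _ = _ := sum_congr rfl fun e' _ => sum_comm

/-! ### The identity -/

/-- **The Fejér pair identity, first form.**  `H · rootPairSum g E E' H = ∑_{0≤k,k'<H} ‖T(k − k')‖²`. [this work] -/
theorem mul_rootPairSum_eq_sum_sum (g : ℤ[X]) (E E' H : ℕ) :
    (H : ℝ) * rootPairSum g E E' H =
      ∑ k ∈ range H, ∑ k' ∈ range H, ‖∑ e ∈ Ioc E E', hooleySum g e ((k : ℤ) - k')‖ ^ 2 := by
  have h1 : ∀ s : ℝ, (H : ℝ) * fejer H s =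
      ∑ kk ∈ range H ×ˢ range H, Real.cos (2 * Real.pi * ((kk.1 : ℝ) - kk.2) * s) := fun s => by
    rw [natCast_mul_fejer, sum_product]
  have h2 : ∀ h : ℤ, ‖∑ e ∈ Ioc E E', hooleySum g e h‖ ^ 2 =
      ∑ pp ∈ rootPoints g E E' ×ˢ rootPoints g E E',
        Real.cos (2 * Real.pi * h * ((pp.1.2 : ℝ) / pp.1.1 - (pp.2.2 : ℝ) / pp.2.1)) := fun h => by
    rw [norm_sq_sum_Ioc_hooleySum, sum_product]
  calc (H : ℝ) * rootPairSum g E E' H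
      = ∑ pp ∈ rootPoints g E E' ×ˢ rootPoints g E E',
          (H : ℝ) * fejer H ((pp.1.2 : ℝ) / pp.1.1 - (pp.2.2 : ℝ) / pp.2.1) := by
        rw [rootPairSum, ← sum_product', mul_sum]
    _ = ∑ pp ∈ rootPoints g E E' ×ˢ rootPoints g E E', ∑ kk ∈ range H ×ˢ range H,
          Real.cos (2 * Real.pi * ((kk.1 : ℝ) - kk.2) * ((pp.1.2 : ℝ) / pp.1.1 - (pp.2.2 : ℝ) / pp.2.1)) :=
        sum_congr rfl fun pp _ => h1 _
    _ = ∑ kk ∈ range H ×ˢ range H, ∑ pp ∈ rootPoints g E E' ×ˢ rootPoints g E E',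
          Real.cos (2 * Real.pi * ((kk.1 : ℝ) - kk.2) * ((pp.1.2 : ℝ) / pp.1.1 - (pp.2.2 : ℝ) / pp.2.1)) :=
        sum_comm
    _ = ∑ kk ∈ range H ×ˢ range H, ‖∑ e ∈ Ioc E E', hooleySum g e ((kk.1 : ℤ) - kk.2)‖ ^ 2 :=
        sum_congr rfl fun kk _ => by rw [h2]; push_cast; rfl
    _ = _ := by rw [sum_product]

/-- **The Fejér pair identity.**  `H · rootPairSum g E E' H = H·N² + ∑_{0≤d<H} (H − (d+1))·(‖T(d+1)‖² + ‖T(−(d+1))‖²)`,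
`N = #rootPoints`. [this work] -/
theorem mul_rootPairSum_eq (g : ℤ[X]) (E E' H : ℕ) :
    (H : ℝ) * rootPairSum g E E' H =
      (H : ℝ) * (#(rootPoints g E E') : ℝ) ^ 2 +
        ∑ d ∈ range H, ((H : ℝ) - (d + 1)) *
          (‖∑ e ∈ Ioc E E', hooleySum g e ((d : ℤ) + 1)‖ ^ 2 +
            ‖∑ e ∈ Ioc E E', hooleySum g e (-((d : ℤ) + 1))‖ ^ 2) := by
  have key := sum_range_sum_range_sub (fun h => ‖∑ e ∈ Ioc E E', hooleySum g e h‖ ^ 2) H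
  beta_reduce at key
  rw [mul_rootPairSum_eq_sum_sum, key, norm_sum_Ioc_hooleySum_zero]

/-! ### The sandwich and the pair-correlation hypothesis -/

/-- Lower half of the sandwich: `rootPairSum(H) − N² ≤ ∑_{1≤h≤H} (‖T(h)‖² + ‖T(−h)‖²)`. [this work] -/
theorem rootPairSum_sub_sq_le (g : ℤ[X]) (E E' H : ℕ) :
    rootPairSum g E E' H - (#(rootPoints g E E') : ℝ) ^ 2 ≤
      ∑ h ∈ Icc 1 H, (‖∑ e ∈ Ioc E E', hooleySum g e h‖ ^ 2 +
        ‖∑ e ∈ Ioc E E', hooleySum g e (-(h : ℤ))‖ ^ 2) := by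
  set a : ℕ → ℝ := fun d => ‖∑ e ∈ Ioc E E', hooleySum g e ((d : ℤ) + 1)‖ ^ 2 +
    ‖∑ e ∈ Ioc E E', hooleySum g e (-((d : ℤ) + 1))‖ ^ 2 with ha
  have ha0 : ∀ d, 0 ≤ a d := fun d => by positivity
  have hIcc : ∑ h ∈ Icc 1 H, (‖∑ e ∈ Ioc E E', hooleySum g e h‖ ^ 2 +
      ‖∑ e ∈ Ioc E E', hooleySum g e (-(h : ℤ))‖ ^ 2) = ∑ d ∈ range H, a d := by
    rw [← Finset.Ico_add_one_right_eq_Icc, sum_Ico_eq_sum_range, Nat.add_sub_cancel]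
    exact sum_congr rfl fun d _ => by simp only [ha, Nat.cast_add, Nat.cast_one, add_comm]
  rcases Nat.eq_zero_or_pos H with rfl | hH
  · have h0 : rootPairSum g E E' 0 = 0 := by simp [rootPairSum, fejer]
    rw [h0, hIcc, sum_range_zero]
    nlinarith
  have hHpos : (0 : ℝ) < H := by exact_mod_cast hH
  have key := mul_rootPairSum_eq g E E' H
  have h1 : ∑ d ∈ range H, ((H : ℝ) - (d + 1)) * a d ≤ (H : ℝ) * ∑ d ∈ range H, a d := by
    rw [mul_sum]
    refine sum_le_sum fun d hd => mul_le_mul_of_nonneg_right ?_ (ha0 d)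
    have : (0 : ℝ) ≤ d := Nat.cast_nonneg d
    linarith
  rw [hIcc]
  refine le_of_mul_le_mul_left ?_ hHpos
  have key' : (H : ℝ) * rootPairSum g E E' H =
      (H : ℝ) * (#(rootPoints g E E') : ℝ) ^ 2 + ∑ d ∈ range H, ((H : ℝ) - (d + 1)) * a d := key
  nlinarith [key', h1]

/-- Upper half of the sandwich: `∑_{1≤h≤H} (‖T(h)‖² + ‖T(−h)‖²) ≤ 2·(rootPairSum(2H) − N²)` for `H ≥ 1`
(the Fejér weights `2H − h ≥ H` on `1 ≤ h ≤ H`). [this work] -/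
theorem sum_Icc_norm_sq_le (g : ℤ[X]) (E E' : ℕ) {H : ℕ} (hH : 1 ≤ H) :
    ∑ h ∈ Icc 1 H, (‖∑ e ∈ Ioc E E', hooleySum g e h‖ ^ 2 +
        ‖∑ e ∈ Ioc E E', hooleySum g e (-(h : ℤ))‖ ^ 2)
      ≤ 2 * (rootPairSum g E E' (2 * H) - (#(rootPoints g E E') : ℝ) ^ 2) := by
  set a : ℕ → ℝ := fun d => ‖∑ e ∈ Ioc E E', hooleySum g e ((d : ℤ) + 1)‖ ^ 2 +
    ‖∑ e ∈ Ioc E E', hooleySum g e (-((d : ℤ) + 1))‖ ^ 2 with ha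
  have ha0 : ∀ d, 0 ≤ a d := fun d => by positivity
  have hIcc : ∑ h ∈ Icc 1 H, (‖∑ e ∈ Ioc E E', hooleySum g e h‖ ^ 2 +
      ‖∑ e ∈ Ioc E E', hooleySum g e (-(h : ℤ))‖ ^ 2) = ∑ d ∈ range H, a d := by
    rw [← Finset.Ico_add_one_right_eq_Icc, sum_Ico_eq_sum_range, Nat.add_sub_cancel]
    exact sum_congr rfl fun d _ => by simp only [ha, Nat.cast_add, Nat.cast_one, add_comm]
  have hHpos : (0 : ℝ) < H := by exact_mod_cast hH
  have key : ((2 * H : ℕ) : ℝ) * rootPairSum g E E' (2 * H) =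
      ((2 * H : ℕ) : ℝ) * (#(rootPoints g E E') : ℝ) ^ 2 +
        ∑ d ∈ range (2 * H), (((2 * H : ℕ) : ℝ) - (d + 1)) * a d := mul_rootPairSum_eq g E E' (2 * H)
  have h1 : (H : ℝ) * ∑ d ∈ range H, a d ≤ ∑ d ∈ range (2 * H), (((2 * H : ℕ) : ℝ) - (d + 1)) * a d := by
    calc (H : ℝ) * ∑ d ∈ range H, a d = ∑ d ∈ range H, (H : ℝ) * a d := mul_sum _ _ _
      _ ≤ ∑ d ∈ range H, (((2 * H : ℕ) : ℝ) - (d + 1)) * a d := by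
          refine sum_le_sum fun d hd => mul_le_mul_of_nonneg_right ?_ (ha0 d)
          have hd' : (d : ℝ) + 1 ≤ H := by exact_mod_cast mem_range.mp hd
          push_cast
          linarith
      _ ≤ ∑ d ∈ range (2 * H), (((2 * H : ℕ) : ℝ) - (d + 1)) * a d := by
          refine sum_le_sum_of_subset_of_nonneg
            (fun x hx => mem_range.mpr ((mem_range.mp hx).trans_le (Nat.le_mul_of_pos_left H two_pos)))
            fun d hd _ => ?_
          refine mul_nonneg ?_ (ha0 d)
          have hd' : (d : ℝ) + 1 ≤ ((2 * H : ℕ) : ℝ) := by exact_mod_cast mem_range.mp hd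
          linarith
  rw [hIcc]
  refine le_of_mul_le_mul_left ?_ hHpos
  push_cast at key h1
  nlinarith [key, h1]

/-- **The pair-correlation hypothesis** with exponents `(θ, η)`: on every dyadic range of moduli and every scale
`1/H` with `H ≤ 2E^θ`, `rootPairSum g E E' H ≤ N² + C·H·E^{2(1−η)}` — the Fejér-smoothed count of ordered pairs of
root fractions at distance `≲ 1/H` exceeds the mean-density prediction `N²` by at most `C·H·E^{2(1−η)}` (a Poissonian
family deviates by `≍ H·N ≍ H·E`, which is `η = 1/2`: the hypothesis with `η ≤ 1/2` forbids clustering beyond the random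
scale and allows any amount of repulsion). [this work] -/
def HooleyPairCorrelationLocal (g : ℤ[X]) (θ η : ℝ) : Prop :=
  ∃ C : ℝ, ∀ E E' H : ℕ, 1 ≤ E → E ≤ E' → E' ≤ 2 * E → (H : ℝ) ≤ 2 * (E : ℝ) ^ θ →
    rootPairSum g E E' H ≤ (#(rootPoints g E E') : ℝ) ^ 2 + C * H * (E : ℝ) ^ (2 * (1 - η))

/-- **Pair correlation ⇒ second moment** (same exponents, constant `4C`). [this work] -/
theorem hooleyMeanSquareLocal_of_pairCorrelation {g : ℤ[X]} {θ η : ℝ}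
    (hyp : HooleyPairCorrelationLocal g θ η) : HooleyMeanSquareLocal g θ η := by
  obtain ⟨C, hC⟩ := hyp
  refine ⟨4 * C, fun E E' H hE hEE' hE' hH => ?_⟩
  rcases Nat.eq_zero_or_pos H with rfl | hHpos
  · simp
  have h2H : ((2 * H : ℕ) : ℝ) ≤ 2 * (E : ℝ) ^ θ := by push_cast; linarith
  have hP := hC E E' (2 * H) hE hEE' hE' h2H
  calc ∑ h ∈ Icc 1 H, (‖∑ e ∈ Ioc E E', hooleySum g e h‖ ^ 2 +
          ‖∑ e ∈ Ioc E E', hooleySum g e (-(h : ℤ))‖ ^ 2)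
      ≤ 2 * (rootPairSum g E E' (2 * H) - (#(rootPoints g E E') : ℝ) ^ 2) := sum_Icc_norm_sq_le g E E' hHpos
    _ ≤ 2 * (C * ((2 * H : ℕ) : ℝ) * (E : ℝ) ^ (2 * (1 - η))) := by linarith
    _ = 4 * C * H * (E : ℝ) ^ (2 * (1 - η)) := by push_cast; ring

/-- **Second moment ⇒ pair correlation** for `H ≤ E^θ` (same exponents and constant): together with
`hooleyMeanSquareLocal_of_pairCorrelation`, the two hypotheses are equivalent up to the factor `2` in the admissible
range of `H`. [this work] -/
theorem HooleyMeanSquareLocal.rootPairSum_le {g : ℤ[X]} {θ η : ℝ} (hyp : HooleyMeanSquareLocal g θ η) :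
    ∃ C : ℝ, ∀ E E' H : ℕ, 1 ≤ E → E ≤ E' → E' ≤ 2 * E → (H : ℝ) ≤ (E : ℝ) ^ θ →
      rootPairSum g E E' H ≤ (#(rootPoints g E E') : ℝ) ^ 2 + C * H * (E : ℝ) ^ (2 * (1 - η)) := by
  obtain ⟨C, hC⟩ := hyp
  refine ⟨C, fun E E' H hE hEE' hE' hH => ?_⟩
  have h1 := rootPairSum_sub_sq_le g E E' H
  have h2 := hC E E' H hE hEE' hE' hH
  linarith

/-- **Cubic corollary.**  For an irreducible cubic `g`, the pair-correlation hypothesis with `θ > 2/3` (`θ ≤ 1`) and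
`η > 1/3` implies Erdős's asymptotic `∑_{n≤x} τ(|g(n)|) ~ 3·A_g·x log x`. [this work] -/
theorem erdosDivisorSumAsymptotic_cubic_of_pairCorrelation {g : ℤ[X]} (hirr : Irreducible g)
    (hdeg : g.natDegree = 3) {θ η : ℝ} (hθ : 2 / 3 < θ) (hθ1 : θ ≤ 1) (hη : 1 / 3 < η)
    (hyp : HooleyPairCorrelationLocal g θ η) : ErdosDivisorSumAsymptotic g :=
  erdosDivisorSumAsymptotic_cubic_of_meanSquare hirr hdeg hθ hθ1 hη (hooleyMeanSquareLocal_of_pairCorrelation hyp)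

end Summit.Parity.BatemanHorn.Theorems
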